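import Summits.Ventures.HodgeRepro2.T5SU11SphericalDecay
import Summits.Ventures.HodgeRepro2.T5SU11SphericalXiAsymptotic

/-!
# The decaying solution at the spectral edge `λ = 1`: `χ_1 = Ξ · ∫_t^∞ ds/(sinh 2s Ξ(a_s)²)`

Row 448 built the decaying solution `χ_λ` for `λ > 1` from the exponential growth of `φ_λ`. At the edge `λ = 1`
(`φ_1 = Ξ`, Harish-Chandra's function) the growth is only `Ξ(a_t) ≥ (4/π) t e^{−t}` (row 343's
`div_mul_exp_le_sph_one_hyp`), but together with `sinh 2t ≥ e^{2t}/4` this still bounds the reduction-of-order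
integrand by **`π²/(4t²)`** for `t ≥ 1` (`roIntegrand_sph_one_le`), which is integrable at infinity
(`integrableOn_roIntegrand_sph_one`; Mathlib's `integrableOn_Ioi_rpow_of_lt`). Hence row 447 applies at `λ = 1`
(`μ = λ(λ − 2) = −1`): **`χ_1 = Ξ · ∫_t^∞ ds/(sinh 2s Ξ(a_s)²)`** (`sphDecay 1`) is a positive solution of
`sinh 2t · u″ + 2 cosh 2t · u′ = −sinh 2t · u` on `(0, ∞)` (`sphDecay_one_ode`, `sphDecay_one_pos`), with
`sinh 2t · (Ξ χ_1′ − Ξ′ χ_1) = −1` (`wronskian_sphDecay_one`), `χ_1/Ξ → 0` at infinity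
(`tendsto_sphDecay_one_div_atTop`), and every solution with `u/Ξ → 0` is a constant multiple of `χ_1`
(`eq_const_mul_sphDecay_one_of_tendsto`): the second solution at the bottom of the continuous spectrum.
Nothing is claimed about (N).

Blind lane: Mathlib + the HodgeRepro2 prefix only; no sorry; axioms ⊆ {propext, Classical.choice,
Quot.sound}.
-/

namespace Summit.Ventures.HodgeRepro2.T5SU11SphericalDecayEdge

open Filter Topology MeasureTheory
open Set (Ioi Ioc)
open scoped Real
open T5SU11Cartan T5SU11SphericalFunction T5SU11SphericalBounds T5SU11SphericalXiAsymptotic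
  T5SU11ReductionOfOrder T5SU11ReductionOfOrderInfinity T5SU11SphericalSolutionSpaceAll T5SU11SphericalDecay

section measure

variable [MeasurableSpace Circle] [BorelSpace Circle]

/-! ### Integrability of the integrand at infinity for `λ = 1` -/

/-- **`1/(sinh 2t · Ξ(a_t)²) ≤ π²/(4 t²)`** for `t ≥ 1`. -/
theorem roIntegrand_sph_one_le {t : ℝ} (ht : 1 ≤ t) :
    roIntegrand (fun t => sph 1 (hyp t)) t ≤ π ^ 2 / 4 * (t ^ 2)⁻¹ := by
  have hπ := Real.pi_pos
  have ht0 : 0 < t := by linarith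
  have hS : Real.exp (2 * t) / 4 ≤ Real.sinh (2 * t) := exp_div_four_le_sinh (by linarith)
  have hΞ : 4 / π * t * Real.exp (-t) ≤ sph 1 (hyp t) := div_mul_exp_le_sph_one_hyp t
  have hΞ0 : 0 < sph 1 (hyp t) := sph_hyp_pos 1 t
  have hden : 0 < Real.sinh (2 * t) * sph 1 (hyp t) ^ 2 :=
    mul_pos (sinh_two_mul_pos ht0) (pow_pos hΞ0 2)
  have hlow : Real.exp (2 * t) / 4 * (4 / π * t * Real.exp (-t)) ^ 2 ≤ Real.sinh (2 * t) * sph 1 (hyp t) ^ 2 :=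
    mul_le_mul hS (pow_le_pow_left₀ (by positivity) hΞ 2) (by positivity) (sinh_two_mul_pos ht0).le
  have key : Real.exp (2 * t) * Real.exp (-t) ^ 2 = 1 := by
    rw [← Real.exp_nat_mul, ← Real.exp_add, show 2 * t + (2 : ℕ) * (-t) = 0 by push_cast; ring, Real.exp_zero]
  have hval : Real.exp (2 * t) / 4 * (4 / π * t * Real.exp (-t)) ^ 2 = 4 / π ^ 2 * t ^ 2 := by
    have e : Real.exp (2 * t) / 4 * (4 / π * t * Real.exp (-t)) ^ 2
        = (4 / π ^ 2 * t ^ 2) * (Real.exp (2 * t) * Real.exp (-t) ^ 2) := by ring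
    rw [e, key, mul_one]
  rw [hval] at hlow
  show 1 / (Real.sinh (2 * t) * sph 1 (hyp t) ^ 2) ≤ _
  calc 1 / (Real.sinh (2 * t) * sph 1 (hyp t) ^ 2) ≤ 1 / (4 / π ^ 2 * t ^ 2) :=
        one_div_le_one_div_of_le (by positivity) hlow
    _ = π ^ 2 / 4 * (t ^ 2)⁻¹ := by
        field_simp

/-- **The reduction-of-order integrand of `Ξ` is integrable on `(1, ∞)`.** -/
theorem integrableOn_roIntegrand_sph_one : IntegrableOn (roIntegrand fun t => sph 1 (hyp t)) (Ioi 1) := by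
  have hmaj : IntegrableOn (fun t : ℝ => π ^ 2 / 4 * t ^ (-2 : ℝ)) (Ioi 1) :=
    (integrableOn_Ioi_rpow_of_lt (by norm_num) one_pos).const_mul _
  refine hmaj.mono' ?_ ?_
  · exact ((continuousOn_roIntegrand (hφ_sph 1) (hpos_sph 1)).mono
      (Set.Ioi_subset_Ioi zero_le_one)).aestronglyMeasurable measurableSet_Ioi
  · refine ae_restrict_of_forall_mem measurableSet_Ioi (fun t ht => ?_)
    have ht' : 1 < t := ht
    have hg : 0 < roIntegrand (fun t => sph 1 (hyp t)) t := by
      show 0 < 1 / (Real.sinh (2 * t) * sph 1 (hyp t) ^ 2)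
      exact div_pos one_pos (mul_pos (sinh_two_mul_pos (by linarith)) (pow_pos (sph_hyp_pos 1 t) 2))
    rw [Real.norm_eq_abs, abs_of_pos hg, Real.rpow_neg (by linarith), Real.rpow_two]
    exact roIntegrand_sph_one_le ht'.le

/-! ### The decaying solution at `λ = 1` -/

/-- `χ_1 = Ξ · ∫_t^∞ ds/(sinh 2s Ξ(a_s)²)`, as `J Ξ − ψ_1` on `(0, ∞)`. -/
theorem sphDecay_one_eq {t : ℝ} (ht : 0 < t) :
    sphDecay 1 t = (∫ s in Ioi 1, roIntegrand (fun t => sph 1 (hyp t)) s) * sph 1 (hyp t) - sphSecond 1 t :=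
  decaySolution_eq (hφ_sph 1) (hpos_sph 1) integrableOn_roIntegrand_sph_one ht

/-- **`χ_1 > 0`** on `(0, ∞)`. -/
theorem sphDecay_one_pos {t : ℝ} (ht : 0 < t) : 0 < sphDecay 1 t :=
  decaySolution_pos (hφ_sph 1) (hpos_sph 1) integrableOn_roIntegrand_sph_one ht

/-- `χ_1′` is the derivative of `χ_1` on `(0, ∞)`. -/
theorem hasDerivAt_sphDecay_one {t : ℝ} (ht : 0 < t) : HasDerivAt (sphDecay 1) (sphDecay' 1 t) t :=
  hasDerivAt_decaySolution (hφ_sph 1) (hpos_sph 1) integrableOn_roIntegrand_sph_one ht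

/-- **`χ_1` solves the radial equation at `λ = 1`**: `sinh 2t · χ_1″ + 2 cosh 2t · χ_1′ = −sinh 2t · χ_1`. -/
theorem sphDecay_one_ode {t : ℝ} (ht : 0 < t) :
    Real.sinh (2 * t) * sphDecay'' 1 t + 2 * Real.cosh (2 * t) * sphDecay' 1 t
      = 1 * (1 - 2) * Real.sinh (2 * t) * sphDecay 1 t :=
  decaySolution_ode (hφ_sph 1) (hpos_sph 1) integrableOn_roIntegrand_sph_one (hode_sph 1) ht

/-- **The Wronskian** `sinh 2t · (Ξ χ_1′ − Ξ′ χ_1) = −1`. -/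
theorem wronskian_sphDecay_one {t : ℝ} (ht : 0 < t) :
    Real.sinh (2 * t) * (sph 1 (hyp t) * sphDecay' 1 t - deriv (fun t => sph 1 (hyp t)) t * sphDecay 1 t) = -1 :=
  wronskian_decaySolution (hφ_sph 1) (hpos_sph 1) integrableOn_roIntegrand_sph_one ht

/-- **`χ_1/Ξ → 0` at infinity.** -/
theorem tendsto_sphDecay_one_div_atTop : Tendsto (fun t => sphDecay 1 t / sph 1 (hyp t)) atTop (𝓝 0) :=
  tendsto_decaySolution_div_atTop (hφ_sph 1) (hpos_sph 1) integrableOn_roIntegrand_sph_one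

/-- **Uniqueness at the edge**: a solution `u` of the radial equation at `λ = 1` with `u/Ξ → 0` at infinity is
`−sinh 2 · (Ξ(a_1) u′(1) − Ξ′(1) u(1)) · χ_1`. -/
theorem eq_const_mul_sphDecay_one_of_tendsto {u u' u'' : ℝ → ℝ}
    (hu : ∀ t, 0 < t → HasDerivAt u (u' t) t) (hu' : ∀ t, 0 < t → HasDerivAt u' (u'' t) t)
    (hode : ∀ t, 0 < t → Real.sinh (2 * t) * u'' t + 2 * Real.cosh (2 * t) * u' t
      = 1 * (1 - 2) * Real.sinh (2 * t) * u t)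
    (hdecay : Tendsto (fun t => u t / sph 1 (hyp t)) atTop (𝓝 0)) {t : ℝ} (ht : 0 < t) :
    u t = -(Real.sinh 2 * (sph 1 (hyp 1) * u' 1 - deriv (fun t => sph 1 (hyp t)) 1 * u 1)) * sphDecay 1 t :=
  eq_const_mul_decaySolution_of_tendsto (hφ_sph 1) (hφ'_sph 1) (hpos_sph 1) integrableOn_roIntegrand_sph_one
    (hode_sph 1) hu hu' hode hdecay ht

/-- Every solution at `λ = 1` with `u/Ξ → 0` is a constant multiple of `χ_1`. -/
theorem exists_eq_const_mul_sphDecay_one_of_tendsto {u u' u'' : ℝ → ℝ}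
    (hu : ∀ t, 0 < t → HasDerivAt u (u' t) t) (hu' : ∀ t, 0 < t → HasDerivAt u' (u'' t) t)
    (hode : ∀ t, 0 < t → Real.sinh (2 * t) * u'' t + 2 * Real.cosh (2 * t) * u' t
      = 1 * (1 - 2) * Real.sinh (2 * t) * u t)
    (hdecay : Tendsto (fun t => u t / sph 1 (hyp t)) atTop (𝓝 0)) :
    ∃ c : ℝ, ∀ t, 0 < t → u t = c * sphDecay 1 t :=
  ⟨_, fun _ ht => eq_const_mul_sphDecay_one_of_tendsto hu hu' hode hdecay ht⟩

end measure

end Summit.Ventures.HodgeRepro2.T5SU11SphericalDecayEdge
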